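import Literature.Analysis.InnerProduct.HilbertComplexCompactnessInvariance
import Literature.Analysis.InnerProduct.HilbertComplexDiscreteSpectrum
import Literature.Analysis.InnerProduct.HilbertComplexFormEmbeddingCompact
import HarnessLib

/-!
# Discreteness is invariant under complex isomorphisms (Brüning–Lesch 1992, Lemma 2.17, first sentence): the Rellich
# property makes the resolvent compact, and an isomorphic discrete complex is discrete

Layer `Literature/Analysis/InnerProduct`, namespace `Literature.Analysis.InnerProduct`; sequel BY NAME of
`HilbertComplexCompactnessInvariance.lean` (row g34-#10: `rellich_of_iso`, the Rellich property passes along an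
isomorphism), `HilbertComplexFormEmbeddingCompact.lean` (row g32: `exists_tendsto_subseq_of_form_bounded`, a discrete
complex has the Rellich property), `HilbertComplexResolvent.lean` (row g32: `graph_norm_sq_resolvent_le`,
`‖Ru‖² + ‖T*Ru‖² + ‖SRu‖² ≤ ‖u‖²`) and `HilbertComplexDiscreteSpectrum.lean` (row g32:
`exists_hilbertBasis_laplacian_eigenvectors`, compact resolvent ⟹ eigenbasis with `μᵢ → ∞`). Lane `lit-hodgefound` (Track 2
foundations library), prover seat `lit-hodgefound-p06` (generation 34), self-proposed row g34-#11. THEOREMS ONLY (no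
definition, no instance, no named fact). The Laplacian `□ = TT* + S*S` is hypothesis-parametrised (`hdom`/`hval`), its
resolvent `R = (1 + □)⁻¹` by `hR : R u ∈ D(□) ∧ Ru + □Ru = u`, discreteness = a Hilbert basis of eigenvectors with
`μᵢ → ∞` (`heig`, `htend`), the Rellich property in the sequential shape of rows g31/g32/g34-#10.

## Source, verbatim

J. Brüning, M. Lesch, *Hilbert complexes*, J. Funct. Anal. 108 (1992), §2 pp. 103–104 (held text
`paper:doi-10-1016-0022-1236-92-90147-b`, p0016–p0017): "This situation calls for an application of the max-min-principle
for which we have to assume, however, that `Δ` has a discrete spectrum; i.e., all spectral values are isolated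
eigenvalues of finite multiplicity, equivalently `spec_e Δ = ∅`. In this case we call the Hilbert complex `(𝒟, D)`
discrete. Thus we arrive at LEMMA 2.17. Discreteness is invariant under complex isomorphisms." And Cor 2.19: "Also,
`0 ∉ spec_e Δ′` or `spec_e Δ′ = ∅` iff the same property holds for `Δ`." K. Schmüdgen, *Unbounded Self-adjoint Operators
on Hilbert Space* (2012), Prop. 10.6: for a lower semibounded self-adjoint `A` with form `𝔱`, `A` has purely discrete
spectrum iff the embedding `(𝒟[𝔱], ‖·‖_𝔱) → ℋ` is compact (iff the resolvent is compact, Prop. 5.12).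

## What is proved (all over `𝕜 = ℝ` or `ℂ`)

* §1 **`isCompactOperator_resolvent_of_rellich`**: if every sequence `uₙ ∈ D(T*) ∩ D(S)` with
  `‖uₙ‖² + ‖T*uₙ‖² + ‖Suₙ‖² ≤ C²` has a convergent subsequence, then the resolvent `R = (1 + □)⁻¹` is a compact operator
  (`R` maps the unit ball into the form-unit-ball, whose closure is sequentially compact, hence compact);
  **`exists_hilbertBasis_of_rellich`**: hence `□` has a Hilbert basis of eigenvectors with eigenvalues `μᵢ → ∞`.
* §2 **`exists_hilbertBasis_laplacian_of_iso`** (Lemma 2.17, first sentence, middle degree): if `(E, F, G; T, S)` is a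
  discrete Hilbert complex (eigenbasis of `□` with `μᵢ → ∞`; `T` densely defined, `S` closed densely defined, `Im T ⊆ Ker S`)
  and `(E′, F′, G′; T′, S′)` is an isomorphic Hilbert complex (data `hgT`, `hkT`, `hkS`, `g_F ∘ k_F = id`) whose Laplacian
  `□′` has a resolvent `R′`, then `□′` has a Hilbert basis of eigenvectors with eigenvalues `→ ∞`: `(𝒟′, D′)` is discrete.

## References

* [BruningLesch1992] J. Brüning, M. Lesch, *Hilbert complexes*, J. Funct. Anal. 108 (1992) 88–132, §2 Lemma 2.17, Cor 2.19.
* [Schmudgen2012] K. Schmüdgen, *Unbounded Self-adjoint Operators on Hilbert Space*, GTM 265, Prop. 5.12, Prop. 10.6.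
* [Kato1966] T. Kato, *Perturbation Theory for Linear Operators*, III §6.8 Thm 6.29 (operators with compact resolvent).
* [ArnoldFalkWinther2010] D. N. Arnold, R. S. Falk, R. Winther, Bull. AMS 47 (2010), §3.1 (compactness property).
-/

noncomputable section

open scoped InnerProductSpace LinearPMap
open Filter Topology

namespace Literature.Analysis.InnerProduct

variable {𝕜 E F G E' F' G' : Type*} [RCLike 𝕜]
variable [NormedAddCommGroup E] [InnerProductSpace 𝕜 E]
variable [NormedAddCommGroup F] [InnerProductSpace 𝕜 F]
variable [NormedAddCommGroup G] [InnerProductSpace 𝕜 G]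
variable [NormedAddCommGroup E'] [InnerProductSpace 𝕜 E']
variable [NormedAddCommGroup F'] [InnerProductSpace 𝕜 F']
variable [NormedAddCommGroup G'] [InnerProductSpace 𝕜 G']

/-! ### §1 The Rellich property makes the resolvent compact, hence gives an eigenbasis -/

section Rellich

variable [CompleteSpace E] [CompleteSpace F]
variable {T : E →ₗ.[𝕜] F} {S : F →ₗ.[𝕜] G} {L : F →ₗ.[𝕜] F} {R : F →L[𝕜] F}

omit [NormedAddCommGroup E'] [InnerProductSpace 𝕜 E'] [NormedAddCommGroup F'] [InnerProductSpace 𝕜 F']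
  [NormedAddCommGroup G'] [InnerProductSpace 𝕜 G'] in
/-- **The compactness (Rellich) property gives a compact resolvent**: if every sequence `uₙ ∈ D(T*) ∩ D(S)` bounded
in the form norm `‖uₙ‖² + ‖T*uₙ‖² + ‖Suₙ‖²` has a convergent subsequence, then `R = (1 + □)⁻¹` is a compact operator —
`R` maps the unit ball into the form-unit-ball (`‖Ru‖² + ‖T*Ru‖² + ‖SRu‖² ≤ ‖u‖²`), whose closure is sequentially compact,
hence compact. [cite: Schmudgen2012, Prop. 10.6 (i) ⇒ (iii) with Prop. 5.12; Kato1966, III §6.8 Thm 6.29; BruningLesch1992,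
§2 p. 103 ("equivalently `spec_e Δ = ∅` … we call the Hilbert complex discrete")] -/
theorem isCompactOperator_resolvent_of_rellich (hdT : Dense (T.domain : Set E)) (hdS : Dense (S.domain : Set F))
    (hdom : ∀ x : F, x ∈ L.domain ↔ (∃ hxT : x ∈ T†.domain, T† ⟨x, hxT⟩ ∈ T.domain) ∧
      (∃ hxS : x ∈ S.domain, S ⟨x, hxS⟩ ∈ S†.domain))
    (hval : ∀ (x : L.domain) (hxT : (x : F) ∈ T†.domain) (hTx : T† ⟨x, hxT⟩ ∈ T.domain)
      (hxS : (x : F) ∈ S.domain) (hSx : S ⟨x, hxS⟩ ∈ S†.domain),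
      L x = T ⟨T† ⟨x, hxT⟩, hTx⟩ + S† ⟨S ⟨x, hxS⟩, hSx⟩)
    (hR : ∀ u : F, ∃ h : R u ∈ L.domain, R u + L ⟨R u, h⟩ = u)
    (hRel : ∀ (u : ℕ → F) (huT : ∀ n, u n ∈ T†.domain) (huS : ∀ n, u n ∈ S.domain) (C : ℝ),
      (∀ n, ‖u n‖ ^ 2 + (‖T† ⟨u n, huT n⟩‖ ^ 2 + ‖S ⟨u n, huS n⟩‖ ^ 2) ≤ C ^ 2) →
        ∃ v : F, ∃ φ : ℕ → ℕ, StrictMono φ ∧ Tendsto (u ∘ φ) atTop (𝓝 v)) :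
    IsCompactOperator R := by
  set K : Set F := closure ((R : F → F) '' Metric.ball 0 1) with hK
  -- every sequence in `R(ball)` has a convergent subsequence
  have himg : ∀ z : ℕ → F, (∀ n, z n ∈ (R : F → F) '' Metric.ball 0 1) →
      ∃ v : F, ∃ φ : ℕ → ℕ, StrictMono φ ∧ Tendsto (z ∘ φ) atTop (𝓝 v) := by
    intro z hz
    choose u hu hzu using hz
    have hL : ∀ n, R (u n) ∈ L.domain := fun n ↦ (hR (u n)).1
    have hzT : ∀ n, z n ∈ T†.domain := fun n ↦ by
      rw [← hzu n]; exact laplacian_domain_le_adjoint_domain hdom (hL n)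
    have hzS : ∀ n, z n ∈ S.domain := fun n ↦ by
      rw [← hzu n]; exact laplacian_domain_le_domain hdom (hL n)
    refine hRel z hzT hzS 1 fun n ↦ ?_
    have hg := graph_norm_sq_resolvent_le hdT hdS hdom hval hR (u n) (hL n)
    have hu1 : ‖u n‖ ^ 2 ≤ 1 ^ 2 := pow_le_pow_left₀ (norm_nonneg _) (mem_ball_zero_iff.1 (hu n)).le 2
    have e1 : T† ⟨z n, hzT n⟩ = T† ⟨R (u n), laplacian_domain_le_adjoint_domain hdom (hL n)⟩ := by
      congr 1; exact Subtype.ext (hzu n).symm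
    have e2 : S ⟨z n, hzS n⟩ = S ⟨R (u n), laplacian_domain_le_domain hdom (hL n)⟩ := by
      congr 1; exact Subtype.ext (hzu n).symm
    rw [e1, e2, ← hzu n]
    linarith
  -- hence the closure is sequentially compact, hence compact
  have hKseq : IsSeqCompact K := by
    intro y hy
    have hz : ∀ n, ∃ z ∈ (R : F → F) '' Metric.ball 0 1, dist (y n) z < 1 / ((n : ℝ) + 1) := fun n ↦
      Metric.mem_closure_iff.1 (hy n) _ (by positivity)
    choose z hzmem hzd using hz
    obtain ⟨v, φ, hφ, hv⟩ := himg z hzmem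
    refine ⟨v, isClosed_closure.mem_of_tendsto hv (Eventually.of_forall fun n ↦ subset_closure (hzmem (φ n))),
      φ, hφ, ?_⟩
    refine hv.congr_dist (squeeze_zero (fun n ↦ dist_nonneg) (fun n ↦ ?_)
      (tendsto_one_div_add_atTop_nhds_zero_nat (𝕜 := ℝ)))
    rw [Function.comp_apply, Function.comp_apply, dist_comm]
    refine (hzd (φ n)).le.trans (one_div_le_one_div_of_le (by positivity) ?_)
    exact_mod_cast Nat.succ_le_succ (hφ.id_le n)
  exact (isCompactOperator_iff_image_ball_subset_compact (R : F →ₗ[𝕜] F) zero_lt_one).2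
    ⟨K, hKseq.isCompact, subset_closure⟩

omit [NormedAddCommGroup E'] [InnerProductSpace 𝕜 E'] [NormedAddCommGroup F'] [InnerProductSpace 𝕜 F']
  [NormedAddCommGroup G'] [InnerProductSpace 𝕜 G'] in
/-- **Rellich property ⟹ discrete**: under the compactness property, `□` has a Hilbert basis of eigenvectors
`b i = i ∈ s ⊆ F` with eigenvalues `0 ≤ μᵢ → ∞` (and `R(b i) = (1 + μᵢ)⁻¹ b i`). [cite: Schmudgen2012, Prop. 10.6,
Prop. 5.12; Kato1966, III §6.8 Thm 6.29; BruningLesch1992, §2 p. 103] -/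
theorem exists_hilbertBasis_of_rellich (hdT : Dense (T.domain : Set E)) (hdS : Dense (S.domain : Set F))
    (hdom : ∀ x : F, x ∈ L.domain ↔ (∃ hxT : x ∈ T†.domain, T† ⟨x, hxT⟩ ∈ T.domain) ∧
      (∃ hxS : x ∈ S.domain, S ⟨x, hxS⟩ ∈ S†.domain))
    (hval : ∀ (x : L.domain) (hxT : (x : F) ∈ T†.domain) (hTx : T† ⟨x, hxT⟩ ∈ T.domain)
      (hxS : (x : F) ∈ S.domain) (hSx : S ⟨x, hxS⟩ ∈ S†.domain),
      L x = T ⟨T† ⟨x, hxT⟩, hTx⟩ + S† ⟨S ⟨x, hxS⟩, hSx⟩)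
    (hR : ∀ u : F, ∃ h : R u ∈ L.domain, R u + L ⟨R u, h⟩ = u)
    (hRel : ∀ (u : ℕ → F) (huT : ∀ n, u n ∈ T†.domain) (huS : ∀ n, u n ∈ S.domain) (C : ℝ),
      (∀ n, ‖u n‖ ^ 2 + (‖T† ⟨u n, huT n⟩‖ ^ 2 + ‖S ⟨u n, huS n⟩‖ ^ 2) ≤ C ^ 2) →
        ∃ v : F, ∃ φ : ℕ → ℕ, StrictMono φ ∧ Tendsto (u ∘ φ) atTop (𝓝 v)) :
    ∃ (s : Set F) (b : HilbertBasis s 𝕜 F) (μ : s → ℝ), ⇑b = ((↑) : s → F) ∧ (∀ i, 0 ≤ μ i) ∧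
      (∀ i, ∃ h : (b i : F) ∈ L.domain, L ⟨b i, h⟩ = ((μ i : ℝ) : 𝕜) • (b i : F)) ∧
      (∀ i, R (b i) = (((1 + μ i)⁻¹ : ℝ) : 𝕜) • (b i : F)) ∧ Tendsto μ cofinite atTop :=
  exists_hilbertBasis_laplacian_eigenvectors hdT hdS hdom hval hR
    (isCompactOperator_resolvent_of_rellich hdT hdS hdom hval hR hRel)

end Rellich

/-! ### §2 Lemma 2.17: an isomorphic image of a discrete Hilbert complex is discrete -/

section Iso

variable [CompleteSpace E] [CompleteSpace F] [CompleteSpace E'] [CompleteSpace F']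
variable {T : E →ₗ.[𝕜] F} {S : F →ₗ.[𝕜] G} {L : F →ₗ.[𝕜] F} {ι : Type*} {b : HilbertBasis ι 𝕜 F} {μ : ι → ℝ}
variable {T' : E' →ₗ.[𝕜] F'} {S' : F' →ₗ.[𝕜] G'} {L' : F' →ₗ.[𝕜] F'} {R' : F' →L[𝕜] F'}
variable {g_E : E →L[𝕜] E'} {g_F : F →L[𝕜] F'} {k_E : E' →L[𝕜] E} {k_F : F' →L[𝕜] F} {k_G : G' →L[𝕜] G}

/-- **Lemma 2.17 (first sentence): "Discreteness is invariant under complex isomorphisms."** Let `(E, F, G; T, S)` be a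
Hilbert complex (`T` densely defined, `S` closed and densely defined, `Im T ⊆ Ker S`) whose Laplacian `□ = TT* + S*S` has
a Hilbert basis of eigenvectors with eigenvalues `μᵢ → ∞`, and let `(E′, F′, G′; T′, S′)` (`T′` densely defined, `S′`
closed densely defined, `Im T′ ⊆ Ker S′`) be isomorphic to it through bounded `(g_E, g_F)` (a map `T → T′`), `(k_E, k_F)`
(a map `T′ → T`), `(k_F, k_G)` (a map `S′ → S`) with `g_F ∘ k_F = id`, and let `R′` be the resolvent of its Laplacian `□′`.
Then `□′` has a Hilbert basis of eigenvectors with eigenvalues `0 ≤ μ′ⱼ → ∞`. Chain: discrete ⟹ Rellich (row g32) ⟹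
Rellich for `(T′, S′)` (row g34-#10, Brüning–Lesch's `k = h ⊕ g`) ⟹ `R′` compact ⟹ eigenbasis (row g32).
[cite: BruningLesch1992, §2 Lemma 2.17, Cor 2.19 ("`spec_e Δ′ = ∅` iff the same property holds for `Δ`");
Schmudgen2012, Prop. 10.6, Prop. 5.12] -/
theorem exists_hilbertBasis_laplacian_of_iso [CompleteSpace G] (hdT : Dense (T.domain : Set E))
    (hdS : Dense (S.domain : Set F))
    (hcS : S.IsClosed) (hST : LinearMap.range T.toFun ≤ (LinearMap.ker S.toFun).map S.domain.subtype)
    (hdom : ∀ x : F, x ∈ L.domain ↔ (∃ hxT : x ∈ T†.domain, T† ⟨x, hxT⟩ ∈ T.domain) ∧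
      (∃ hxS : x ∈ S.domain, S ⟨x, hxS⟩ ∈ S†.domain))
    (hval : ∀ (x : L.domain) (hxT : (x : F) ∈ T†.domain) (hTx : T† ⟨x, hxT⟩ ∈ T.domain)
      (hxS : (x : F) ∈ S.domain) (hSx : S ⟨x, hxS⟩ ∈ S†.domain),
      L x = T ⟨T† ⟨x, hxT⟩, hTx⟩ + S† ⟨S ⟨x, hxS⟩, hSx⟩)
    (heig : ∀ i, ∃ h : (b i : F) ∈ L.domain, L ⟨b i, h⟩ = ((μ i : ℝ) : 𝕜) • (b i : F))
    (htend : Tendsto μ cofinite atTop)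
    (hdT' : Dense (T'.domain : Set E')) (hdS' : Dense (S'.domain : Set F')) (hcS' : S'.IsClosed)
    (hST' : LinearMap.range T'.toFun ≤ (LinearMap.ker S'.toFun).map S'.domain.subtype)
    (hdom' : ∀ x : F', x ∈ L'.domain ↔ (∃ hxT : x ∈ T'†.domain, T'† ⟨x, hxT⟩ ∈ T'.domain) ∧
      (∃ hxS : x ∈ S'.domain, S' ⟨x, hxS⟩ ∈ S'†.domain))
    (hval' : ∀ (x : L'.domain) (hxT : (x : F') ∈ T'†.domain) (hTx : T'† ⟨x, hxT⟩ ∈ T'.domain)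
      (hxS : (x : F') ∈ S'.domain) (hSx : S' ⟨x, hxS⟩ ∈ S'†.domain),
      L' x = T' ⟨T'† ⟨x, hxT⟩, hTx⟩ + S'† ⟨S' ⟨x, hxS⟩, hSx⟩)
    (hR' : ∀ u : F', ∃ h : R' u ∈ L'.domain, R' u + L' ⟨R' u, h⟩ = u)
    (hgT : ∀ (w : E) (hw : w ∈ T.domain), ∃ h : g_E w ∈ T'.domain, T' ⟨g_E w, h⟩ = g_F (T ⟨w, hw⟩))
    (hkT : ∀ (w' : E') (hw' : w' ∈ T'.domain), ∃ h : k_E w' ∈ T.domain, T ⟨k_E w', h⟩ = k_F (T' ⟨w', hw'⟩))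
    (hkS : ∀ (u' : F') (hu' : u' ∈ S'.domain), ∃ h : k_F u' ∈ S.domain, S ⟨k_F u', h⟩ = k_G (S' ⟨u', hu'⟩))
    (hgk_F : ∀ u' : F', g_F (k_F u') = u') :
    ∃ (s : Set F') (b' : HilbertBasis s 𝕜 F') (μ' : s → ℝ), ⇑b' = ((↑) : s → F') ∧ (∀ j, 0 ≤ μ' j) ∧
      (∀ j, ∃ h : (b' j : F') ∈ L'.domain, L' ⟨b' j, h⟩ = ((μ' j : ℝ) : 𝕜) • (b' j : F')) ∧
      (∀ j, R' (b' j) = (((1 + μ' j)⁻¹ : ℝ) : 𝕜) • (b' j : F')) ∧ Tendsto μ' cofinite atTop :=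
  exists_hilbertBasis_of_rellich hdT' hdS' hdom' hval' hR'
    (rellich_of_iso hdT hcS hST hdT' hcS' hST' hgT hkT hkS hgk_F fun _ huT huS _ hC ↦
      exists_tendsto_subseq_of_form_bounded hdT hdS hcS hdom hval heig htend huT huS hC)

end Iso

end Literature.Analysis.InnerProduct
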